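import Summits.Ventures.CertifiedArithmetic.LowPrec.Successor

/-!
# Double rounding of sums through a wider format: when is it innocuous?

HONEST FRAMING (venture CertifiedArithmetic / cell `pub-lowprec`): certified error envelopes and
provably optimal rounding/accumulation schemes for low-precision formats under stated cost models;
every table by two implementations; no hardware or vendor claims.

A mixed-precision pipeline that adds two data of a narrow format `φ` in a WIDE format `ψ` and then
converts the result to `φ` computes `fl_φ(fl_ψ(a + b))`, two roundings-to-nearest-even in a row.
DOUBLE ROUNDING THEOREM (`MiniFloat.toRat_roundNE_roundNE_add`): if `ψ` has precision
`p_ψ ≥ 2·p_φ + 1` (`manBits` form: `2·m_φ + 2 ≤ m_ψ`), an exponent range starting no higher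
(`bias_φ ≤ bias_ψ`) and reaching at least as far (`maxRat φ ≤ maxRat ψ`), then for ALL data
`a, b : MiniFloat φ` the double rounding is innocuous: `fl_φ(fl_ψ(a + b)) = fl_φ(a + b)` as values
— under the cell's SATURATING round-to-nearest-even in both formats, subnormals included. This is
the binary case of Figueroa's condition for addition ("target precision `p`, wider precision
`p + p'`: innocuous if `p' ≥ p + 1`") [Figueroa1995; quoted in MartinDorelMelquiondMuller2013, §1],
there stated for unbounded exponents / IEEE overflow; the saturating statement and the format-pair
verdicts (`DoubleRoundingVerdicts.lean`) are this development's contribution (Lean, kernel-checked).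

Proof (structure, not enumeration): if `s = a + b` is not a `ψ`-value, let `v = RD_φ(s) ≥ 0`
(w.l.o.g. `s > 0`), `G = ulp(v)`, `u = v + G` the next `φ`-value and `M = v + G/2` the midpoint,
a `ψ`-value (`Successor.lean`); `w = fl_ψ(s)` lies in `[v, M]` or `[M, u]` on the side of `s`
(monotonicity), and `fl_φ` is constant on `[v, M)` and on `(M, u]`; the only harmful event is
`w = M ≠ s`, and then `|s - M| < G·2^-(m_ψ-m_φ)` (standard model in `ψ`) contradicts the
arithmetic of `s = a + b`: `2(M - s)` is a nonzero multiple of `min(ulp a, ulp b, G)`-many quanta,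
which forces the smaller operand below `G/4` and the larger one (a `φ`-value) strictly within `G/2`
of the midpoint `M` — impossible (`MiniFloat.sum_eq_midpoint_of_close`).

Products need no such theorem in this cell: FP8/FP6/FP4 products are exact in the wide formats
(`Exact.lean`), so `fl_φ(fl_ψ(a·b)) = fl_φ(a·b)` trivially (`toRat_roundNE_roundNE_of_exists`).
Deliberately NOT here: other operations (division, square root: Figueroa's `2p`, `2p + 2`),
double rounding of arbitrary reals (never innocuous), directed modes (always innocuous).
-/

namespace Literature.ComputerArithmetic.FloatingPoint

namespace MiniFloat

open Format

variable {φ ψ : Format}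

/-! ### The arithmetic core: a sum of two data cannot sit just off a midpoint -/

/-- CORE LEMMA (ordered operands): let `v ≥ 0` be a value of `φ` with ulp `G = 2^(expCode v - 1)`
quanta such that no value of `φ` lies strictly between `v` and `v + G`, and let `M = v + G/2` be
the midpoint. If a sum `c + c'` of two data (`|c| ≤ |c'|` in magnitude) is within `G / 2^j` of
`M` for some `j ≥ m + 2`, then it IS `M`. (Divisibility: `2(M - (c + c'))` is a nonzero multiple
of `min(ulp c, G)` quanta; the small case forces `|c| < G/4` and puts the value `c'` strictly
within `G/2` of `M`, where no value is.) [folklore] -/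
theorem sum_eq_midpoint_of_close {j : ℕ} (hj : φ.manBits + 2 ≤ j) (v c c' : MiniFloat φ)
    (hcc : c.scaledMag ≤ c'.scaledMag)
    (hgap : ∀ y : MiniFloat φ, y.toRat ≤ v.toRat ∨
      v.toRat + 2 ^ (v.expCode - 1) * φ.quantum ≤ y.toRat)
    (hclose : |c.toRat + c'.toRat - (v.toRat + 2 ^ (v.expCode - 1) * φ.quantum / 2)|
      < 2 ^ (v.expCode - 1) * φ.quantum / 2 ^ j) :
    c.toRat + c'.toRat = v.toRat + 2 ^ (v.expCode - 1) * φ.quantum / 2 := by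
  by_contra hne
  have hq := φ.quantum_pos
  have hj4 : (4 : ℤ) ≤ 2 ^ j := by
    calc (4 : ℤ) = 2 ^ 2 := by norm_num
      _ ≤ 2 ^ j := pow_le_pow_right₀ (by norm_num) (by omega)
  have hj4q : (4 : ℚ) ≤ 2 ^ j := by exact_mod_cast hj4
  set e := v.expCode - 1 with he
  set ec := c.expCode - 1 with hec
  -- the integer `Z` with `Z · quantum = 2 (M - s)`
  set Z : ℤ := 2 * v.toInt + 2 ^ e - 2 * c.toInt - 2 * c'.toInt with hZ
  have hZq : (Z : ℚ) * φ.quantum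
      = 2 * ((v.toRat + 2 ^ e * φ.quantum / 2) - (c.toRat + c'.toRat)) := by
    simp only [hZ, toRat_eq_toInt_mul]; push_cast; ring
  have hZne : Z ≠ 0 := by
    intro h0
    apply hne
    have : (Z : ℚ) * φ.quantum = 0 := by rw [h0]; simp
    rw [hZq] at this
    linarith
  -- `|Z| · 2^j < 2^(e+1)`
  have hZlt : |Z| * 2 ^ j < 2 ^ (e + 1) := by
    have h1 : (|Z| : ℚ) * φ.quantum < 2 * (2 ^ e * φ.quantum / 2 ^ j) := by
      rw [show |(Z : ℚ)| * φ.quantum = |(Z : ℚ) * φ.quantum| by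
        rw [abs_mul, abs_of_pos hq], hZq, abs_mul, abs_two, abs_sub_comm]
      linarith
    have h2 : (|Z| : ℚ) * 2 ^ j * φ.quantum < 2 ^ (e + 1) * φ.quantum := by
      have hj0 : (0 : ℚ) < 2 ^ j := by positivity
      rw [pow_succ]
      have := mul_lt_mul_of_pos_right h1 hj0
      calc (|Z| : ℚ) * 2 ^ j * φ.quantum = (|Z| : ℚ) * φ.quantum * 2 ^ j := by ring
        _ < 2 * (2 ^ e * φ.quantum / 2 ^ j) * 2 ^ j := this
        _ = 2 ^ e * 2 * φ.quantum := by field_simp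
    have h3 := lt_of_mul_lt_mul_right h2 hq.le
    exact_mod_cast h3
  -- divisibility of the signed magnitudes
  have dv : ((2 ^ e : ℕ) : ℤ) ∣ v.toInt := pow_ulpExp_dvd_toInt le_rfl
  have dc : ((2 ^ ec : ℕ) : ℤ) ∣ c.toInt := pow_ulpExp_dvd_toInt le_rfl
  have dc' : ((2 ^ ec : ℕ) : ℤ) ∣ c'.toInt := pow_ulpExp_dvd_toInt hcc
  push_cast at dv dc dc'
  rcases le_or_gt e ec with hle | hlt
  · -- `ulp v ≤ ulp c`: `Z` is an odd multiple of `2^e`, so `|Z| ≥ 2^e`, contradicting `j ≥ 2`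
    have hpow : (2 : ℤ) ^ e ∣ 2 ^ ec := pow_dvd_pow 2 hle
    obtain ⟨V', hV'⟩ := dv
    obtain ⟨C, hC⟩ := dvd_trans hpow dc
    obtain ⟨C', hC'⟩ := dvd_trans hpow dc'
    have hZodd : Z = 2 ^ e * (2 * (V' - C - C') + 1) := by rw [hZ, hV', hC, hC']; ring
    have habs : (2 : ℤ) ^ e ≤ |Z| := by
      rw [hZodd, abs_mul, abs_of_pos (by positivity : (0:ℤ) < 2 ^ e)]
      have : (1 : ℤ) ≤ |2 * (V' - C - C') + 1| := Int.one_le_abs (by omega)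
      nlinarith [this, (by positivity : (0:ℤ) < 2 ^ e)]
    have h1 : (2 : ℤ) ^ e * 2 ^ j < 2 ^ e * 2 := by
      calc (2 : ℤ) ^ e * 2 ^ j ≤ |Z| * 2 ^ j := mul_le_mul_of_nonneg_right habs (by positivity)
        _ < 2 ^ (e + 1) := hZlt
        _ = 2 ^ e * 2 := pow_succ _ _
    have h2 := lt_of_mul_lt_mul_left h1 (by positivity : (0:ℤ) ≤ 2 ^ e)
    omega
  · -- `ulp c < ulp v`: `2^(ec+1) ∣ Z ≠ 0`, so `ec + j < e`: `c` is tiny and `c'` is too close to `M`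
    have hpow : (2 : ℤ) ^ ec ∣ 2 ^ e := pow_dvd_pow 2 hlt.le
    have hdvdZ : (2 : ℤ) ^ (ec + 1) ∣ Z := by
      have h2v : (2 : ℤ) ^ (ec + 1) ∣ 2 * v.toInt := by
        rw [pow_succ, mul_comm _ (2:ℤ)]; exact mul_dvd_mul_left 2 (dvd_trans hpow dv)
      have h2c : (2 : ℤ) ^ (ec + 1) ∣ 2 * c.toInt := by
        rw [pow_succ, mul_comm _ (2:ℤ)]; exact mul_dvd_mul_left 2 dc
      have h2c' : (2 : ℤ) ^ (ec + 1) ∣ 2 * c'.toInt := by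
        rw [pow_succ, mul_comm _ (2:ℤ)]; exact mul_dvd_mul_left 2 dc'
      have h2e : (2 : ℤ) ^ (ec + 1) ∣ 2 ^ e := pow_dvd_pow 2 (by omega)
      rw [hZ]
      exact dvd_sub (dvd_sub (dvd_add h2v h2e) h2c) h2c'
    have habs : (2 : ℤ) ^ (ec + 1) ≤ |Z| :=
      Int.le_of_dvd (abs_pos.mpr hZne) ((dvd_abs _ _).mpr hdvdZ)
    have h1 : (2 : ℤ) ^ (ec + 1 + j) < 2 ^ (e + 1) := by
      calc (2 : ℤ) ^ (ec + 1 + j) = 2 ^ (ec + 1) * 2 ^ j := pow_add _ _ _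
        _ ≤ |Z| * 2 ^ j := mul_le_mul_of_nonneg_right habs (by positivity)
        _ < 2 ^ (e + 1) := hZlt
    have h2 : ec + 1 + j < e + 1 := (pow_lt_pow_iff_right₀ (by norm_num : (1:ℤ) < 2)).mp h1
    -- `|c| < G/4`
    have hcsmall : 4 * |c.toRat| < 2 ^ e * φ.quantum := by
      rw [abs_toRat]
      have h3 := scaledMag_lt_pow_ulpExp c
      rw [← hec] at h3
      have h4 : 2 ^ (φ.manBits + 1 + ec) * 4 ≤ 2 ^ e := by
        rw [show (4:ℕ) = 2 ^ 2 by norm_num, ← pow_add]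
        exact Nat.pow_le_pow_right (by norm_num) (by omega)
      have h5 : 4 * c.scaledMag < 2 ^ e := by omega
      have h6 : (4 : ℚ) * c.scaledMag < 2 ^ e := by exact_mod_cast h5
      nlinarith
    -- `|c' - M| < G/2`
    have hc'close : |c'.toRat - (v.toRat + 2 ^ e * φ.quantum / 2)| < 2 ^ e * φ.quantum / 2 := by
      have hG : (0:ℚ) < 2 ^ e * φ.quantum := by positivity
      have h3 : 2 ^ e * φ.quantum / 2 ^ j ≤ 2 ^ e * φ.quantum / 4 :=
        div_le_div_of_nonneg_left hG.le (by norm_num) hj4q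
      calc |c'.toRat - (v.toRat + 2 ^ e * φ.quantum / 2)|
          = |(c.toRat + c'.toRat - (v.toRat + 2 ^ e * φ.quantum / 2)) - c.toRat| := by ring_nf
        _ ≤ |c.toRat + c'.toRat - (v.toRat + 2 ^ e * φ.quantum / 2)| + |c.toRat| :=
            abs_sub _ _
        _ < 2 ^ e * φ.quantum / 2 ^ j + 2 ^ e * φ.quantum / 4 := by linarith
        _ ≤ 2 ^ e * φ.quantum / 2 := by linarith
    -- but `c'` is a value: `c' ≤ v` or `c' ≥ v + G`
    rcases hgap c' with h | h
    · have : v.toRat + 2 ^ e * φ.quantum / 2 - c'.toRat ≤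
          |c'.toRat - (v.toRat + 2 ^ e * φ.quantum / 2)| := by
        rw [abs_sub_comm]; exact le_abs_self _
      have hG : (0:ℚ) < 2 ^ e * φ.quantum := by positivity
      linarith
    · have : c'.toRat - (v.toRat + 2 ^ e * φ.quantum / 2) ≤
          |c'.toRat - (v.toRat + 2 ^ e * φ.quantum / 2)| := le_abs_self _
      have hG : (0:ℚ) < 2 ^ e * φ.quantum := by positivity
      linarith

/-- CORE LEMMA (either order of the operands). [folklore] -/
theorem add_eq_midpoint_of_close {j : ℕ} (hj : φ.manBits + 2 ≤ j) (v a b : MiniFloat φ)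
    (hgap : ∀ y : MiniFloat φ, y.toRat ≤ v.toRat ∨
      v.toRat + 2 ^ (v.expCode - 1) * φ.quantum ≤ y.toRat)
    (hclose : |a.toRat + b.toRat - (v.toRat + 2 ^ (v.expCode - 1) * φ.quantum / 2)|
      < 2 ^ (v.expCode - 1) * φ.quantum / 2 ^ j) :
    a.toRat + b.toRat = v.toRat + 2 ^ (v.expCode - 1) * φ.quantum / 2 := by
  rcases le_total a.scaledMag b.scaledMag with h | h
  · exact sum_eq_midpoint_of_close hj v a b h hgap hclose
  · rw [add_comm] at hclose ⊢
    exact sum_eq_midpoint_of_close hj v b a h hgap hclose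

/-! ### The double rounding theorem -/

/-- DOUBLE ROUNDING OF SUMS, positive case. [cite: Figueroa1995, §2] -/
theorem toRat_roundNE_roundNE_add_of_pos (hm : 2 * φ.manBits + 2 ≤ ψ.manBits)
    (hb : φ.bias ≤ ψ.bias) (hmax : φ.maxRat ≤ ψ.maxRat) (a b : MiniFloat φ)
    (hs : 0 < a.toRat + b.toRat) :
    (roundNE φ (roundNE ψ (a.toRat + b.toRat)).toRat).toRat
      = (roundNE φ (a.toRat + b.toRat)).toRat := by
  set s := a.toRat + b.toRat with hs_def
  have hqφ := φ.quantum_pos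
  have hqψ := ψ.quantum_pos
  have hmle : φ.manBits ≤ ψ.manBits := by omega
  have hq : ψ.qexp ≤ φ.qexp := qexp_le_of_le hmle hb
  by_cases hex : ∃ z : MiniFloat ψ, z.toRat = s
  · exact toRat_roundNE_roundNE_of_exists hex
  by_cases hbig : φ.maxRat ≤ s
  · -- both roundings into `φ` saturate
    have htop : ∃ z : MiniFloat ψ, z.toRat = φ.maxRat := by
      obtain ⟨z, hz⟩ := exists_toRat_eq_of_le hmle hq hmax (top φ)
      exact ⟨z, by rw [hz, toRat_top]⟩
    have hw : φ.maxRat ≤ (roundNE ψ s).toRat := by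
      have h1 := toRat_roundNE_mono (φ := ψ) hbig
      rwa [toRat_roundNE_of_exists htop] at h1
    rw [toRat_roundNE_of_maxRat_le_pos hw, toRat_roundNE_of_maxRat_le_pos hbig]
  have hbig' : s < φ.maxRat := not_le.mp hbig
  have hnsφ : ¬ ∃ y : MiniFloat φ, y.toRat = s := by
    rintro ⟨y, hy⟩
    obtain ⟨z, hz⟩ := exists_toRat_eq_of_le hmle hq hmax y
    exact hex ⟨z, hz.trans hy⟩
  obtain ⟨hv0, hvs, hsu, ⟨u, hu⟩, hgap⟩ := roundDown_bracket hs hbig' hnsφ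
  set v := roundDown φ s with hv_def
  set G := 2 ^ (v.expCode - 1) * φ.quantum with hG_def
  have hG : 0 < G := by positivity
  have hvψ : ∃ z : MiniFloat ψ, z.toRat = v.toRat := exists_toRat_eq_of_le hmle hq hmax v
  have huψ : ∃ z : MiniFloat ψ, z.toRat = v.toRat + G := by
    obtain ⟨z, hz⟩ := exists_toRat_eq_of_le hmle hq hmax u
    exact ⟨z, hz.trans hu⟩
  have hMψ : ∃ z : MiniFloat ψ, z.toRat = v.toRat + G / 2 :=
    exists_toRat_eq_midpoint (by omega) hb hmax hv0 hu
  have hsM : s ≠ v.toRat + G / 2 := by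
    intro h; obtain ⟨z, hz⟩ := hMψ; exact hex ⟨z, hz.trans h.symm⟩
  -- the wide rounding error is below `G / 2^j`, `j = m_ψ - m_φ ≥ m_φ + 2`
  obtain ⟨j, hj⟩ : ∃ j, ψ.manBits = φ.manBits + j := ⟨ψ.manBits - φ.manBits, by omega⟩
  have hjge : φ.manBits + 2 ≤ j := by omega
  set w := (roundNE ψ s).toRat with hw_def
  have hclose : |s - w| < G / 2 ^ j := by
    have hsabs : |s| ≤ ψ.maxRat := by rw [abs_of_pos hs]; linarith
    refine lt_of_le_of_lt (abs_sub_roundNE_le_max hsabs) (max_lt ?_ ?_)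
    · -- `u_ψ · s < G / 2^j` since `s < v + G ≤ 2^(m_φ+1+e) quantum_φ`
      rw [abs_of_pos hs, Format.unitRoundoff_eq, hj]
      have h1 : s < 2 ^ (φ.manBits + 1 + (v.expCode - 1)) * φ.quantum :=
        lt_of_lt_of_le hsu (toRat_add_ulp_le hv0)
      have h2 : (0:ℚ) < 2 ^ (φ.manBits + j + 1) := by positivity
      calc 1 / 2 ^ (φ.manBits + j + 1) * s
          < 1 / 2 ^ (φ.manBits + j + 1) * (2 ^ (φ.manBits + 1 + (v.expCode - 1)) * φ.quantum) :=
            mul_lt_mul_of_pos_left h1 (by positivity)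
        _ = G / 2 ^ j := by rw [hG_def]; field_simp; ring
    · -- `quantum_ψ / 2 < G / 2^j` since `quantum_φ = 2^(j+k) quantum_ψ` and `G ≥ quantum_φ`
      have hquant := quantum_eq_pow_mul_quantum hmle hb (φ := φ) (ψ := ψ)
      rw [hj, Nat.add_sub_cancel_left, pow_add] at hquant
      have hk : (1:ℚ) ≤ 2 ^ (ψ.bias - φ.bias) := one_le_pow₀ (by norm_num)
      have he1 : (1:ℚ) ≤ 2 ^ (v.expCode - 1) := one_le_pow₀ (by norm_num)
      have hj0 : (0:ℚ) < 2 ^ j := by positivity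
      rw [hG_def, hquant, lt_div_iff₀ hj0]
      calc ψ.quantum / 2 * 2 ^ j < ψ.quantum * 2 ^ j := by
            apply mul_lt_mul_of_pos_right _ hj0; linarith
        _ = 1 * (2 ^ j * 1 * ψ.quantum) := by ring
        _ ≤ 2 ^ (v.expCode - 1) * (2 ^ j * 2 ^ (ψ.bias - φ.bias) * ψ.quantum) := by gcongr
  rcases lt_or_gt_of_ne hsM with hlt | hgt
  · -- `s < M`: `w ∈ [v, M]`
    have hwv : v.toRat ≤ w := by
      have := toRat_roundNE_mono (φ := ψ) hvs.le; rwa [toRat_roundNE_of_exists hvψ] at this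
    have hwM : w ≤ v.toRat + G / 2 := by
      have := toRat_roundNE_mono (φ := ψ) hlt.le; rwa [toRat_roundNE_of_exists hMψ] at this
    rcases eq_or_lt_of_le hwM with hwEq | hwLt
    · exfalso; apply hsM
      apply add_eq_midpoint_of_close hjge v a b hgap
      rw [← hs_def, ← hG_def]
      calc |s - (v.toRat + G / 2)| = |s - w| := by rw [hwEq]
        _ < G / 2 ^ j := hclose
    · rw [toRat_roundNE_eq_of_forall_lt ⟨v, rfl⟩ (forall_lt_of_mem_low hgap hwv hwLt),
        toRat_roundNE_eq_of_forall_lt ⟨v, rfl⟩ (forall_lt_of_mem_low hgap hvs.le hlt)]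
  · -- `s > M`: `w ∈ [M, v + G]`
    have hwu : w ≤ v.toRat + G := by
      have := toRat_roundNE_mono (φ := ψ) hsu.le; rwa [toRat_roundNE_of_exists huψ] at this
    have hwM : v.toRat + G / 2 ≤ w := by
      have := toRat_roundNE_mono (φ := ψ) hgt.le; rwa [toRat_roundNE_of_exists hMψ] at this
    rcases eq_or_lt_of_le hwM with hwEq | hwGt
    · exfalso; apply hsM
      apply add_eq_midpoint_of_close hjge v a b hgap
      rw [← hs_def, ← hG_def]
      calc |s - (v.toRat + G / 2)| = |s - w| := by rw [← hwEq]
        _ < G / 2 ^ j := hclose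
    · rw [toRat_roundNE_eq_of_forall_lt ⟨u, rfl⟩ (forall_lt_of_mem_high hu hgap hwGt hwu),
        toRat_roundNE_eq_of_forall_lt ⟨u, rfl⟩ (forall_lt_of_mem_high hu hgap hgt hsu.le)]

/-- DOUBLE ROUNDING OF SUMS IS INNOCUOUS WHEN `p_ψ ≥ 2 p_φ + 1`: for formats `φ`, `ψ` with
`2·m_φ + 2 ≤ m_ψ` (precisions `p_ψ ≥ 2p_φ + 1`), `bias_φ ≤ bias_ψ` and `maxRat φ ≤ maxRat ψ`, and
ALL data `a, b : MiniFloat φ`: `fl_φ(fl_ψ(a + b)) = fl_φ(a + b)` as values (both roundings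
round-to-nearest-even, saturating; subnormals included). [cite: Figueroa1995, §2] -/
theorem toRat_roundNE_roundNE_add (hm : 2 * φ.manBits + 2 ≤ ψ.manBits) (hb : φ.bias ≤ ψ.bias)
    (hmax : φ.maxRat ≤ ψ.maxRat) (a b : MiniFloat φ) :
    (roundNE φ (roundNE ψ (a.toRat + b.toRat)).toRat).toRat
      = (roundNE φ (a.toRat + b.toRat)).toRat := by
  rcases lt_trichotomy 0 (a.toRat + b.toRat) with hpos | hzero | hneg
  · exact toRat_roundNE_roundNE_add_of_pos hm hb hmax a b hpos
  · exact toRat_roundNE_roundNE_of_exists ⟨MiniFloat.zero ψ, by rw [toRat_zero]; exact hzero⟩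
  · have h := toRat_roundNE_roundNE_add_of_pos hm hb hmax (flipSign a) (flipSign b)
      (by rw [toRat_flipSign, toRat_flipSign]; linarith)
    rw [toRat_flipSign, toRat_flipSign, show -a.toRat + -b.toRat = -(a.toRat + b.toRat) by ring,
      toRat_roundNE_neg, toRat_roundNE_neg, toRat_roundNE_neg, neg_inj] at h
    exact h

/-- The same for the datum-level addition of `ErrorTables.lean`: `fadd φ` applied after `fadd ψ`
(wide add, then convert) has the value of `fadd φ` (narrow add). [cite: Figueroa1995, §2] -/
theorem toRat_roundNE_fadd (hm : 2 * φ.manBits + 2 ≤ ψ.manBits) (hb : φ.bias ≤ ψ.bias)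
    (hmax : φ.maxRat ≤ ψ.maxRat) (a b : MiniFloat φ) :
    (roundNE φ (fadd ψ a b).toRat).toRat = (fadd φ a b).toRat := by
  rw [toRat_fadd, toRat_fadd, toRat_roundNE_roundNE_add hm hb hmax]

end MiniFloat

end Literature.ComputerArithmetic.FloatingPoint
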